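import Mathlib
import HarnessLib
import Literature.MathematicalPhysics.KineticTheory.InfiniteChainInvariantStates
import Literature.MathematicalPhysics.KineticTheory.InfiniteChainPartialMomentumReversal
import Literature.Barriers.AtomisticToContinuum.MacroErgodicityHypothesis
import Summits.AtomisticToContinuum.FouriersLaw.Theses.ParityLiouvilleSeed
import Summits.AtomisticToContinuum.FouriersLaw.Theorems.ParityLiouvilleSeedCesaroUpgrade

/-!
# `LiouvilleForHeat` from the catalogued macro-ergodicity hypothesis (conditional closure)

Support file for item `stmt-AtomisticToContinuum-13980` of route `ParityLiouvilleSeed`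
(`Summit.AtomisticToContinuum.FouriersLaw.Theses.ParityLiouvilleSeed.LiouvilleForHeat`), and for
its crux sibling `stmt-AtomisticToContinuum-12073` (`ZeroCurrentRigidity`).

It records, as kernel-checked implications, where these two items sit relative to the barrier
catalogue: the OPEN named statement
`Literature.Barriers.AtomisticToContinuum.MacroErgodicityHypothesis` (Bernardin 2014, Def. 1,
for the conjunct's pinned chain) implies `ZeroCurrentRigidity` (its ODD SECTOR: Gibbs mixtures are
invariant under the reversal of finitely many momenta, and `j₀` is odd under the reversal of
`p₀, p₁`), and hence — through the proved glue `cesaroUpgrade_proof : CesaroUpgrade` — implies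
`LiouvilleForHeat`. Both theorems are CONDITIONAL on the open hypothesis (taken as an explicit
argument; nothing is asserted about it).

Contents (all proved):
* `isGibbsMixture_map_momentumReversalOn`: a Gibbs mixture `ν = ∫ μ_T π(dT)` is invariant under
  every finite partial momentum reversal `R_S` (each DLR state is,
  `IsChainGibbsMeasure.map_momentumReversalOn`; Giry-monad bookkeeping);
* `isGibbsMixture_integral_bondCurrentZ_eq_zero`: `∫ j_x dν = 0` for every Gibbs mixture;
* `integral_bondCurrentZ_eq_zero_of_isMacroErgodic`: for a macro-ergodic chain every
  shift-invariant, time-invariant, regular probability measure has zero mean bond current;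
* `zeroCurrentRigidity_of_macroErgodicityHypothesis`, `liouvilleForHeat_of_macroErgodicityHypothesis`.
-/

noncomputable section

namespace Summit.AtomisticToContinuum.FouriersLaw.Theorems.ParityLiouvilleSeed

open MeasureTheory
open Literature.MathematicalPhysics.KineticTheory.HeatConduction

/-- **A Gibbs mixture is invariant under every finite partial momentum reversal**
`R_S : p_x ↦ -p_x (x ∈ S)`: each DLR state is (`IsChainGibbsMeasure.map_momentumReversalOn`), and
the push-forward of `π.bind κ` along `R_S` is `π.bind (κ · ∘ R_S⁻¹)`. [folklore] -/
theorem isGibbsMixture_map_momentumReversalOn {P : OscillatorChain} {ν : Measure ChainConfig}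
    (h : IsGibbsMixture P ν) (S : Finset ℤ) : ν.map (momentumReversalOn S) = ν := by
  obtain ⟨π, κ, hπ, hκ, hae, rfl⟩ := h
  have hR : Measurable (momentumReversalOn S) := measurable_momentumReversalOn S
  calc (π.bind κ).map (momentumReversalOn S)
        = (π.bind κ).bind fun σ => Measure.dirac (momentumReversalOn S σ) :=
          (Measure.bind_dirac_eq_map _ hR).symm
    _ = π.bind fun T => (κ T).bind fun σ => Measure.dirac (momentumReversalOn S σ) :=
          Measure.bind_bind hκ.aemeasurable (Measure.measurable_dirac.comp hR).aemeasurable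
    _ = π.bind fun T => (κ T).map (momentumReversalOn S) := by
          congr 1
          funext T
          exact Measure.bind_dirac_eq_map _ hR
    _ = π.bind κ :=
          Measure.bind_congr_right (hae.mono fun T hT => hT.2.map_momentumReversalOn S)

/-- **Gibbs mixtures carry no mean current**: `∫ j_x dν = 0` for every mixture of DLR states of
any chain (`j_x` is odd under `R_{{x, x+1}}`; no integrability needed, Bochner junk being `0` on
both sides). [folklore] -/
theorem isGibbsMixture_integral_bondCurrentZ_eq_zero {P : OscillatorChain} {ν : Measure ChainConfig}
    (h : IsGibbsMixture P ν) (x : ℤ) : ∫ σ, P.bondCurrentZ σ x ∂ν = 0 :=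
  integral_eq_zero_of_momentumReversalOn_odd (isGibbsMixture_map_momentumReversalOn h {x, x + 1})
    fun σ => P.bondCurrentZ_momentumReversalOn_of_mem σ (by simp) (by simp)

/-- **Odd sector of macro-ergodicity**: for a macro-ergodic chain (Bernardin 2014, Def. 1) every
shift-invariant, time-invariant, regular probability measure has zero mean bond current.
[folklore] -/
theorem integral_bondCurrentZ_eq_zero_of_isMacroErgodic {P : OscillatorChain}
    (hP : IsMacroErgodic P) {ν : Measure ChainConfig} (hprob : IsProbabilityMeasure ν)
    (hS : IsShiftInvariant ν) (hT : IsTimeInvariant P ν) (hR : IsRegular P ν) (x : ℤ) :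
    ∫ σ, P.bondCurrentZ σ x ∂ν = 0 :=
  isGibbsMixture_integral_bondCurrentZ_eq_zero (hP ν hprob hS hT hR) x

/-- **`MacroErgodicityHypothesis → ZeroCurrentRigidity`** (item `stmt-AtomisticToContinuum-12073`
is the odd sector of the catalogued open hypothesis; CONDITIONAL — the hypothesis is an explicit
argument). [folklore] -/
theorem zeroCurrentRigidity_of_macroErgodicityHypothesis
    (h : Literature.Barriers.AtomisticToContinuum.MacroErgodicityHypothesis) :
    Summit.AtomisticToContinuum.FouriersLaw.Theses.ParityLiouvilleSeed.ZeroCurrentRigidity := by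
  intro ω₂ lam β γ hω hl hβ ν hprob hS hT hR _
  exact integral_bondCurrentZ_eq_zero_of_isMacroErgodic (h ω₂ lam β γ hω hl hβ) hprob hS hT hR 0

/-- **`MacroErgodicityHypothesis → LiouvilleForHeat`** (item `stmt-AtomisticToContinuum-13980`,
CONDITIONAL on the catalogued open hypothesis): the odd sector of macro-ergodicity
(`zeroCurrentRigidity_of_macroErgodicityHypothesis`) composed with the proved Cesàro glue
`cesaroUpgrade_proof : ZeroCurrentRigidity → LiouvilleForHeat`. [folklore] -/
theorem liouvilleForHeat_of_macroErgodicityHypothesis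
    (h : Literature.Barriers.AtomisticToContinuum.MacroErgodicityHypothesis) :
    Summit.AtomisticToContinuum.FouriersLaw.Theses.ParityLiouvilleSeed.LiouvilleForHeat :=
  cesaroUpgrade_proof (zeroCurrentRigidity_of_macroErgodicityHypothesis h)

/-- **`ZeroCurrentRigidity → LiouvilleForHeat`**, restated under the item's name: the Liouville
theorem for heat follows from its shift-invariant special case (this IS `cesaroUpgrade_proof`;
recorded here so that the dependency of item 13980 on item 12073 is citable by one name).
[folklore] -/
theorem liouvilleForHeat_of_zeroCurrentRigidity
    (hZ : Summit.AtomisticToContinuum.FouriersLaw.Theses.ParityLiouvilleSeed.ZeroCurrentRigidity) :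
    Summit.AtomisticToContinuum.FouriersLaw.Theses.ParityLiouvilleSeed.LiouvilleForHeat :=
  cesaroUpgrade_proof hZ

end Summit.AtomisticToContinuum.FouriersLaw.Theorems.ParityLiouvilleSeed

end
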